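import Mathlib
import Summits.Ventures.PercRepro2.KPrimeReduction
import Summits.Ventures.PercRepro2.KPrimeDelProb
import Summits.Ventures.PercRepro2.KPrimeLeakGlueO1

/-!
# The `(0,1)`-class retains the avoidance of a vertex by `a₂` at least as well as `N` does
(blind cell PercRepro2, mine-c g38; `conjectures/MINE-C.md` §47.8, fact (a))

For the frozen glue `Glue = YS·(H_/·D₀ − H·D₀_/) + Sm·(O1_/·D₀ − O1·D₀_/) − Sm·(D_/·D₀ − D·D₀_/)`
of `KPrimeLeakLinear.lean`, §47.8 identifies its PA-tilt step as the ONE-WORLD inequality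
`Sm·(Bev_Z̄·D₀ − Bev·D₀_Z̄) ≥ (Sm − YS)·(H_Z̄·D₀ − H·D₀_Z̄)` with `Z̄ = {a₂ ↮ z}`, which follows from
two facts; this file proves the first, **(a)**: `P((0,1)) · P(N ∩ Z̄) ≤ P((0,1) ∩ Z̄) · P(N)`
(`cls01_avoid_a2_pa_harris`; also in the form `{a₂ ↮ z}`, `cls01_avoid_a2_pa_harris'`).  The proof
is `cls01_avoid_pa_harris` (`KPrimeLeakGlueO1.lean`) with `z`'s avoided set `{a₂}` in place of
`{a₂, v}`: the fibration over the avoided cluster of `a₁` for the deletion-stable events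
`{a₂ ↮ v}` and `{z ↮ a₂}`, Harris inside the fibre (`delProb_mul_le_delProb_inter`) and BHK 1.3
for the two monotone functionals `1[y ∈ K]·P_{G∖K}(a₂ ↮ v)` and `P_{G∖K}(z ↮ a₂)` (`bhk_induced`).
-/

namespace Summit.Ventures.PercRepro2

namespace KPrime

variable {V : Type*} {E : Type*} [Fintype E] [DecidableEq E] [Fintype V] [DecidableEq V]
  {R : Type*} [Field R] [LinearOrder R] [IsStrictOrderedRing R]

section PAHarrisA2

variable {ends : E → Sym2 V} {a₁ a₂ v y z : V} {p : E → R}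

omit [Fintype E] [DecidableEq E] [Fintype V] [DecidableEq V] [Field R] [LinearOrder R]
  [IsStrictOrderedRing R] in
/-- `{z ↮ a₂} = {a₂ ↮ z}`. -/
lemma avoidAll_singleton_comm : avoidAll ends z {a₂} = avoidAll ends a₂ {z} := by
  ext ω
  simp only [avoidAll, Set.mem_setOf_eq, Finset.mem_singleton, forall_eq]
  exact ⟨fun h hc => h (conn_symm hc), fun h hc => h (conn_symm hc)⟩

/-- **PA–Harris in the base world, one avoided vertex**: for `z ≠ a₂` and `Z̄ = {z ↮ a₂}`,
`P((0,1)) · P(N ∩ Z̄) ≤ P((0,1) ∩ Z̄) · P(N)` — the `(0,1)`-class retains the avoidance of `z` by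
`a₂` at least as well as `N` does (fact (a) of `MINE-C.md` §47.8: half of the tilt step of the
frozen glue).  Same proof as `cls01_avoid_pa_harris` with `z`'s avoided set `{a₂}` in place of
`{a₂, v}`: `{z ↮ a₂}` is deletion-stable along the cluster of `a₁` on `{a₁ ↮ a₂}`. -/
theorem cls01_avoid_a2_pa_harris (hp : IsProbVec p) (hza₂ : z ≠ a₂) :
    prob p (cls01 ends a₁ a₂ v y) * prob p (N ends a₁ a₂ v ∩ avoidAll ends z {a₂}) ≤
      prob p (cls01 ends a₁ a₂ v y ∩ avoidAll ends z {a₂}) * prob p (N ends a₁ a₂ v) := by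
  classical
  set X : Finset V := {a₂, v} with hX
  set A : Set (Config E) := avoidAll ends a₂ {v} with hA
  set Z : Set (Config E) := avoidAll ends z {a₂} with hZ
  set 𝓤y : Set (Set V) := {K : Set V | y ∈ K} with h𝓤y
  have hzX : z ∉ ({a₂} : Finset V) := by simp [hza₂]
  -- deletion stability of `A`, `Z`, `A ∩ Z` along the avoided cluster of `a₁`
  have hAst : ∀ ω : Config E, ω ∈ avoidAll ends a₁ X →
      (ω ∈ A ↔ delConfig ends (cluster ends ω a₁) ω ∈ A) := by
    intro ω hω
    -- `{a₂ ↮ v}` is the avoidance of `a₂` of the set `{v}`; `a₂ ∉ cluster a₁` on `N`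
    have ha₂K : a₂ ∉ cluster ends ω a₁ := fun h => hω a₂ (by simp [hX]) h
    have e := cluster_delConfig_cluster (ends := ends) (ω := ω) (s := a₁) ha₂K
    simp only [hA, avoidAll, Set.mem_setOf_eq, Finset.mem_singleton, forall_eq]
    constructor
    · intro h hc
      have hc' : v ∈ cluster ends (delConfig ends (cluster ends ω a₁) ω) a₂ := hc
      rw [e] at hc'; exact h hc'
    · intro h hc
      have hc' : v ∈ cluster ends ω a₂ := hc
      rw [← e] at hc'; exact h hc'
  have hZst : ∀ ω : Config E, ω ∈ avoidAll ends a₁ X →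
      (ω ∈ Z ↔ delConfig ends (cluster ends ω a₁) ω ∈ Z) := by
    intro ω hω
    have hω' : ω ∈ avoidAll ends a₁ {a₂} := fun x hx => hω x (by simp [hX] at hx ⊢; exact Or.inl hx)
    exact deletionStable_avoidAll a₁ z hzX hω'
  have hAZst : ∀ ω : Config E, ω ∈ avoidAll ends a₁ X →
      (ω ∈ A ∩ Z ↔ delConfig ends (cluster ends ω a₁) ω ∈ A ∩ Z) := by
    intro ω hω
    simp only [Set.mem_inter_iff, hAst ω hω, hZst ω hω]
  -- the three masses as expectations over the cluster of `a₁`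
  have e1 := prob_clusterIn_inter_avoid_inter_eq_expect p ends a₁ (X := X) 𝓤y A hAst
  have e2 := prob_clusterIn_inter_avoid_inter_eq_expect p ends a₁ (X := X) Set.univ Z hZst
  have e3 := prob_clusterIn_inter_avoid_inter_eq_expect p ends a₁ (X := X) 𝓤y (A ∩ Z) hAZst
  -- the functionals
  set gA := delProb p ends A with hgA
  set gZ := delProb p ends Z with hgZ
  have hgA_mono : Monotone gA := delProb_mono hp (isLowerSet_avoidAll a₂ {v})
  have hgZ_mono : Monotone gZ := delProb_mono hp (isLowerSet_avoidAll z {a₂})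
  have hgA0 : ∀ W, 0 ≤ gA W := fun W => delProb_nonneg hp A W
  have hgZ0 : ∀ W, 0 ≤ gZ W := fun W => delProb_nonneg hp Z W
  have hF₁ : Monotone (fun K : Set V => 𝓤y.indicator (1 : Set V → R) K * gA K) := by
    intro K K' h
    have h1 := monotone_indicator_one_of_isUpperSet (R := R) (isUpperSet_mem y) h
    have h2 := hgA_mono h
    have h3 : 0 ≤ 𝓤y.indicator (1 : Set V → R) K := Set.indicator_apply_nonneg fun _ => zero_le_one
    exact mul_le_mul h1 h2 (hgA0 K) (le_trans h3 h1)
  have hF₁0 : ∀ K, 0 ≤ 𝓤y.indicator (1 : Set V → R) K * gA K := fun K =>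
    mul_nonneg (Set.indicator_apply_nonneg fun _ => zero_le_one) (hgA0 K)
  -- BHK 1.3 for the avoided cluster of `a₁`
  have key := bhk_induced p hp ends a₁ hF₁ hgZ_mono hF₁0 hgZ0 Finset.univ X X
    (Finset.subset_univ _) (Finset.subset_univ _)
  simp only [Finset.inter_self, Finset.union_self, REvent_univ] at key
  have e : ∀ F : Set V → R,
      clusterObs ends Finset.univ a₁ F * (avoidAll ends a₁ X).indicator 1 =
        fun ω => F (cluster ends ω a₁) * (avoidAll ends a₁ X).indicator 1 ω := by
    intro F
    funext ω
    simp only [Pi.mul_apply, clusterObs_apply, clusterIn_univ]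
  rw [e, e, e] at key
  simp only [Pi.mul_apply] at key
  -- Harris inside the fibre: `gA · gZ ≤ delProb (A ∩ Z)`
  have hjoint : expect p (fun ω => 𝓤y.indicator (1 : Set V → R) (cluster ends ω a₁) *
      gA (cluster ends ω a₁) * gZ (cluster ends ω a₁) * (avoidAll ends a₁ X).indicator 1 ω) ≤
      expect p (fun ω => 𝓤y.indicator (1 : Set V → R) (cluster ends ω a₁) *
        delProb p ends (A ∩ Z) (cluster ends ω a₁) * (avoidAll ends a₁ X).indicator 1 ω) := by
    refine expect_mono hp fun ω => ?_
    have hind : 0 ≤ 𝓤y.indicator (1 : Set V → R) (cluster ends ω a₁) :=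
      Set.indicator_apply_nonneg fun _ => zero_le_one
    have hav : 0 ≤ (avoidAll ends a₁ X).indicator (1 : Config E → R) ω :=
      Set.indicator_apply_nonneg fun _ => zero_le_one
    have hh : gA (cluster ends ω a₁) * gZ (cluster ends ω a₁) ≤
        delProb p ends (A ∩ Z) (cluster ends ω a₁) :=
      delProb_mul_le_delProb_inter (ends := ends) hp (B₁ := A) (B₂ := Z)
        (isLowerSet_avoidAll (ends := ends) a₂ {v}) (isLowerSet_avoidAll (ends := ends) z {a₂})
        (cluster ends ω a₁)
    calc 𝓤y.indicator (1 : Set V → R) (cluster ends ω a₁) * gA (cluster ends ω a₁) *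
          gZ (cluster ends ω a₁) * (avoidAll ends a₁ X).indicator 1 ω
        = 𝓤y.indicator (1 : Set V → R) (cluster ends ω a₁) *
            (gA (cluster ends ω a₁) * gZ (cluster ends ω a₁)) *
            (avoidAll ends a₁ X).indicator 1 ω := by ring
      _ ≤ 𝓤y.indicator (1 : Set V → R) (cluster ends ω a₁) *
            delProb p ends (A ∩ Z) (cluster ends ω a₁) * (avoidAll ends a₁ X).indicator 1 ω := by
          gcongr
  -- translate the expectations back into masses
  have e1' : expect p (fun ω => 𝓤y.indicator (1 : Set V → R) (cluster ends ω a₁) *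
      gA (cluster ends ω a₁) * (avoidAll ends a₁ X).indicator 1 ω) = prob p (cls01 ends a₁ a₂ v y) := by
    rw [cls01_eq_clusterIn_inter, ← hX, ← hA, ← h𝓤y, e1]
  have e2' : expect p (fun ω => gZ (cluster ends ω a₁) * (avoidAll ends a₁ X).indicator 1 ω) =
      prob p (N ends a₁ a₂ v ∩ avoidAll ends z {a₂}) := by
    have : N ends a₁ a₂ v ∩ avoidAll ends z {a₂} =
        clusterInEvent ends a₁ Set.univ ∩ Z ∩ avoidAll ends a₁ X := by
      ext ω
      simp only [Set.mem_inter_iff, mem_clusterInEvent, Set.mem_univ, true_and, hZ, hX, N]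
      exact and_comm
    rw [this, e2]
    congr 1
    funext ω
    simp
  have e3' : expect p (fun ω => 𝓤y.indicator (1 : Set V → R) (cluster ends ω a₁) *
      delProb p ends (A ∩ Z) (cluster ends ω a₁) * (avoidAll ends a₁ X).indicator 1 ω) =
      prob p (cls01 ends a₁ a₂ v y ∩ avoidAll ends z {a₂}) := by
    have : cls01 ends a₁ a₂ v y ∩ avoidAll ends z {a₂} =
        clusterInEvent ends a₁ 𝓤y ∩ (A ∩ Z) ∩ avoidAll ends a₁ X := by
      rw [cls01_eq_clusterIn_inter, ← hX, ← hA, ← h𝓤y, ← hZ]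
      ext ω
      simp only [Set.mem_inter_iff]
      tauto
    rw [this, e3]
  have hN : prob p (avoidAll ends a₁ X) = prob p (N ends a₁ a₂ v) := rfl
  rw [e1', e2', hN] at key
  have key2 : expect p (fun ω => 𝓤y.indicator (1 : Set V → R) (cluster ends ω a₁) *
      gA (cluster ends ω a₁) * gZ (cluster ends ω a₁) * (avoidAll ends a₁ X).indicator 1 ω) *
      prob p (N ends a₁ a₂ v) ≤
      prob p (cls01 ends a₁ a₂ v y ∩ avoidAll ends z {a₂}) * prob p (N ends a₁ a₂ v) := by
    rw [← e3']
    exact mul_le_mul_of_nonneg_right hjoint (prob_nonneg hp _)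
  exact le_trans key key2

/-- Fact (a) in the form `Z̄ = {a₂ ↮ z}`. -/
theorem cls01_avoid_a2_pa_harris' (hp : IsProbVec p) (hza₂ : z ≠ a₂) :
    prob p (cls01 ends a₁ a₂ v y) * prob p (N ends a₁ a₂ v ∩ avoidAll ends a₂ {z}) ≤
      prob p (cls01 ends a₁ a₂ v y ∩ avoidAll ends a₂ {z}) * prob p (N ends a₁ a₂ v) := by
  rw [← avoidAll_singleton_comm]
  exact cls01_avoid_a2_pa_harris hp hza₂

end PAHarrisA2

end KPrime

end Summit.Ventures.PercRepro2
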